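import Literature.MathematicalPhysics.QuantumManyBody.PeriodicBoseGasTagged
import HarnessLib

/-!
# Route `BECProbeMassFlow`, crux `RecoilTransfer` (stmt-AtomisticToContinuum-12311):
# stub `stub_zeroMomentumLift`

Support file for the crux `RecoilTransfer` of route `BECProbeMassFlow`
(`AtomisticToContinuum/BoseEinsteinCondensation`), line `registered` (skeleton `Lines/birth.lean`,
v2): it proves the stub `stub_zeroMomentumLift` (exact registered name and signature, in the
namespace `…BoseEinsteinCondensation.Theorems`), the **zero-momentum lift** — the UPPER bound on
the mass-deformed tagged ground-state energy `E_κ(N, L) = taggedPeriodicGroundStateEnergy v κ N L`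
by the pinned-scatterer energy:
`E_κ(N, L) ≤ (1 + κ N) · impurityPeriodicEnergy v 0 χ` for every pinned trial state `χ` (`0 < L`).

Proof. Lift `χ` (`N` bosons, scatterer pinned at `0`) to the tagged state of zero total momentum
`Ψ(x₀, Y) = L^{-3/2} χ(Y - x₀𝟙)`, i.e. `Ψ(X) = (√(L³))⁻¹ χ(x₁ - x₀, …, x_N - x₀)`
(`zeroMomentumLift_exists`: `C¹`; periodic in every particle — a shift of `x₀` by `L e_k` shifts
all relative coordinates by `-L e_k`; bath-symmetric; normalised, by Tonelli with the tagged
coordinate outermost and the shift of the fundamental cell). Energy: the bath gradients of `Ψ` are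
those of `χ`, the tagged one is `-∑ⱼ ∇ⱼχ`, so `|∇₀Ψ|² ≤ N ∑ⱼ |∇ⱼχ|²` (Cauchy–Schwarz), and on
the slice `X = (x₀, Y)` the potential `∑ⱼ v^per(xⱼ - x₀) + ∑_{i<j} v^per(xᵢ - xⱼ)` is the pinned
one at the relative configuration; integrating (Tonelli, shift of the cell) gives
`⟨Ψ, H_κ Ψ⟩ ≤ (1 + κN) ⟨χ, (H + ∑ⱼ v^per(xⱼ)) χ⟩` (`taggedPeriodicEnergy_zeroMomentumLift_le`),
and the variational principle `taggedPeriodicGroundStateEnergy_le` concludes. Elementary; every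
`v ≥ 0` (hard cores included), every `κ` (`κ ≤ 0` acts as `0`), every `N` (`N = 0`: empty sums).
-/

noncomputable section

open MeasureTheory
open scoped ENNReal NNReal

namespace Summit.AtomisticToContinuum.BoseEinsteinCondensation.Theorems

open Literature.MathematicalPhysics.QuantumManyBody.BoseGas

variable {N : ℕ} {L : ℝ}

/-! ### Periodicity under a common lattice shift of all particles -/

/-- A function of `N` particles that is `Lℤ³`-periodic in every particle and axis is invariant
under the simultaneous shift of all particles by `L e_k` (peel off one `Pi.single` at a time).
[folklore] -/
private theorem apply_add_const_single {α : Sort*} {F : Config N → α}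
    (hF : ∀ (X : Config N) (i : Fin N) (k : Fin 3),
      F (X + Pi.single i (EuclideanSpace.single k L)) = F X)
    (X : Config N) (k : Fin 3) :
    F (X + fun _ => EuclideanSpace.single k L) = F X := by
  suffices h : ∀ s : Finset (Fin N),
      F (X + ∑ i ∈ s, Pi.single i (EuclideanSpace.single k L)) = F X by
    have hsum : (fun _ : Fin N => EuclideanSpace.single k L) =
        ∑ i : Fin N, Pi.single i (EuclideanSpace.single k L) :=
      (Finset.univ_sum_single fun _ : Fin N => EuclideanSpace.single k L).symm
    rw [hsum]
    exact h _
  intro s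
  induction s using Finset.induction_on with
  | empty => rw [Finset.sum_empty, add_zero]
  | insert i s hi ih =>
      rw [Finset.sum_insert hi, add_comm (Pi.single i _) _, ← add_assoc, hF, ih]

/-! ### The lift `X ↦ c · f(x₁ - x₀, …, x_N - x₀)`: admissibility -/

/-- The lift of a periodic `N`-body function is periodic in all `N + 1` particles: shifting the
tagged particle `0` shifts every relative coordinate by `-L e_k`, shifting a bath particle shifts
one. [folklore] -/
private theorem lift_periodic {f : Config N → ℂ}
    (hf : ∀ (Z : Config N) (i : Fin N) (k : Fin 3),
      f (Z + Pi.single i (EuclideanSpace.single k L)) = f Z)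
    (c : ℂ) (X : Config (N + 1)) (i : Fin (N + 1)) (k : Fin 3) :
    c * f (fun j => (X + Pi.single i (EuclideanSpace.single k L) : Config (N + 1)) j.succ -
        (X + Pi.single i (EuclideanSpace.single k L) : Config (N + 1)) 0) =
      c * f (fun j => X j.succ - X 0) := by
  congr 1
  refine Fin.cases ?_ (fun i' => ?_) i
  · have h : (fun j : Fin N =>
          (X + Pi.single (0 : Fin (N + 1)) (EuclideanSpace.single k L) : Config (N + 1)) j.succ -
          (X + Pi.single (0 : Fin (N + 1)) (EuclideanSpace.single k L) : Config (N + 1)) 0) =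
        (fun j => X j.succ - X 0) - fun _ => EuclideanSpace.single k L := by
      funext j
      simp only [Pi.add_apply, Pi.sub_apply, Pi.single_eq_same,
        Pi.single_eq_of_ne (Fin.succ_ne_zero j), add_zero, sub_add_eq_sub_sub]
    rw [h, ← apply_add_const_single hf ((fun j : Fin N => X j.succ - X 0) -
      fun _ => EuclideanSpace.single k L) k, sub_add_cancel]
  · have h : (fun j : Fin N =>
          (X + Pi.single i'.succ (EuclideanSpace.single k L) : Config (N + 1)) j.succ -
          (X + Pi.single i'.succ (EuclideanSpace.single k L) : Config (N + 1)) 0) =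
        (fun j => X j.succ - X 0) + Pi.single i' (EuclideanSpace.single k L) := by
      funext j
      simp only [Pi.add_apply, Pi.single_eq_of_ne' (Fin.succ_ne_zero i'), add_zero]
      simp only [Pi.single_apply, Fin.succ_inj, add_sub_right_comm]
    rw [h, hf]

/-- The lift of a Bose-symmetric `N`-body function is symmetric under the permutations of the
`N + 1` labels fixing the tag `0` (they permute the relative coordinates). [folklore] -/
private theorem lift_symm (χ : PeriodicTrialState N L) (c : ℂ) {σ : Equiv.Perm (Fin (N + 1))}
    (hσ : σ 0 = 0) (X : Config (N + 1)) :
    c * χ.ψ (fun j => (X ∘ σ) j.succ - (X ∘ σ) 0) = c * χ.ψ (fun j => X j.succ - X 0) := by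
  obtain ⟨τ, hτ⟩ := exists_perm_bath hσ
  have h : (fun j => (X ∘ σ) j.succ - (X ∘ σ) 0) = (fun j : Fin N => X j.succ - X 0) ∘ τ := by
    funext j
    simp only [Function.comp_apply, hτ, hσ]
  rw [h, χ.symm]

/-- **Tonelli with the tagged coordinate outermost, then shift of the fundamental cell**: for a
measurable `G ≥ 0` periodic in every particle and axis,
`∫_{[0,L)^{3(N+1)}} G(x₁ - x₀, …, x_N - x₀) dX = L³ ∫_{[0,L)^{3N}} G` (`0 < L`). [folklore] -/
private theorem lintegral_cellN_succ_rel (hL : 0 < L) {G : Config N → ℝ≥0∞} (hG : Measurable G)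
    (hGper : ∀ (Z : Config N) (i : Fin N) (k : Fin 3),
      G (Z + Pi.single i (EuclideanSpace.single k L)) = G Z) :
    ∫⁻ X in cellN (N + 1) L, G (fun j => X j.succ - X 0) =
      ENNReal.ofReal L ^ 3 * ∫⁻ Z in cellN N L, G Z := by
  have hA : Measurable fun X : Config (N + 1) => fun j : Fin N => X j.succ - X 0 :=
    measurable_pi_lambda _ fun j => (measurable_pi_apply _).sub (measurable_pi_apply _)
  have hF : Measurable fun X : Config (N + 1) => G (fun j : Fin N => X j.succ - X 0) := hG.comp hA
  rw [setLIntegral_cellN_succ_left hF]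
  have hinner : ∀ x : Space,
      ∫⁻ Y in cellN N L, G (fun j : Fin N => (Matrix.vecCons x Y : Config (N + 1)) j.succ -
          (Matrix.vecCons x Y : Config (N + 1)) 0) = ∫⁻ Z in cellN N L, G Z := by
    intro x
    have h1 : (fun Y : Config N => G (fun j : Fin N =>
        (Matrix.vecCons x Y : Config (N + 1)) j.succ - (Matrix.vecCons x Y : Config (N + 1)) 0)) =
        fun Y => G (Y + -fun _ => x) := by
      funext Y
      simp only [Matrix.cons_val_succ, Matrix.cons_val_zero]
      exact congrArg G (funext fun j => sub_eq_add_neg (Y j) x)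
    rw [h1]
    exact lintegral_cellN_comp_add hL hGper _
  simp only [hinner]
  rw [setLIntegral_const, volume_cell, mul_comm]

/-- **Normalisation of the lift**: `∫_{[0,L)^{3(N+1)}} |L^{-3/2} χ(x₁ - x₀, …)|² dX = 1`.
[folklore] -/
private theorem lintegral_normSq_lift (hL : 0 < L) (χ : PeriodicTrialState N L) :
    ∫⁻ X in cellN (N + 1) L,
        (‖((Real.sqrt (L ^ 3))⁻¹ : ℂ) * χ.ψ (fun j => X j.succ - X 0)‖₊ : ℝ≥0∞) ^ 2 = 1 := by
  have hL3 : ENNReal.ofReal L ^ 3 ≠ 0 := pow_ne_zero _ (ENNReal.ofReal_pos.2 hL).ne'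
  have hL3' : ENNReal.ofReal L ^ 3 ≠ ⊤ := ENNReal.pow_ne_top ENNReal.ofReal_ne_top
  simp only [nnnorm_mul, ENNReal.coe_mul, mul_pow]
  rw [lintegral_const_mul' _ _ (ENNReal.pow_ne_top ENNReal.coe_ne_top),
    lintegral_cellN_succ_rel hL χ.measurable_normSq (fun Z i k => by rw [χ.periodic]),
    χ.norm_eq, mul_one, nnnorm_constantMode_sq hL, ENNReal.inv_mul_cancel hL3 hL3']

/-- **The zero-momentum lift is an admissible tagged state.** For `0 < L` and a pinned-scatterer
trial state `χ` (`N` periodic bosons), `Ψ(x₀, x₁, …, x_N) = (√(L³))⁻¹ χ(x₁ - x₀, …, x_N - x₀)` — the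
state `L^{-3/2} χ(Y - x₀𝟙)` of total momentum `0` — is a `TaggedPeriodicTrialState N L`: `C¹`,
periodic in every particle, symmetric in the bath, normalised. [folklore] -/
theorem zeroMomentumLift_exists (hL : 0 < L) (χ : PeriodicTrialState N L) :
    ∃ Ψ : TaggedPeriodicTrialState N L,
      Ψ.ψ = fun X => ((Real.sqrt (L ^ 3))⁻¹ : ℂ) * χ.ψ (fun j => X j.succ - X 0) :=
  ⟨{ ψ := fun X => ((Real.sqrt (L ^ 3))⁻¹ : ℂ) * χ.ψ (fun j => X j.succ - X 0)
     contDiff := contDiff_const.mul (χ.contDiff.comp (contDiff_pi' fun j =>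
       (contDiff_apply ℝ Space j.succ).sub (contDiff_apply ℝ Space 0)))
     periodic := fun X i k => lift_periodic χ.periodic _ X i k
     symm := fun _ hσ X => lift_symm χ _ hσ X
     norm_eq := lintegral_normSq_lift hL χ }, rfl⟩

/-! ### The lift: derivatives -/

/-- Chain rule for the lift through the (linear) relative-coordinate map
`X ↦ (x₁ - x₀, …, x_N - x₀)`. [folklore] -/
private theorem hasFDerivAt_lift {f : Config N → ℂ} (hf : Differentiable ℝ f) (c : ℂ)
    (X : Config (N + 1)) :
    HasFDerivAt (fun X : Config (N + 1) => c * f (fun j => X j.succ - X 0))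
      (c • (fderiv ℝ f (fun j => X j.succ - X 0)).comp
        (ContinuousLinearMap.pi fun j : Fin N =>
          (ContinuousLinearMap.proj (R := ℝ) (φ := fun _ : Fin (N + 1) => Space) j.succ -
            ContinuousLinearMap.proj (R := ℝ) (φ := fun _ : Fin (N + 1) => Space) 0))) X := by
  set A : Config (N + 1) →L[ℝ] Config N := ContinuousLinearMap.pi fun j : Fin N =>
    (ContinuousLinearMap.proj (R := ℝ) (φ := fun _ : Fin (N + 1) => Space) j.succ -
      ContinuousLinearMap.proj (R := ℝ) (φ := fun _ : Fin (N + 1) => Space) 0) with hA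
  have hAX : ∀ Y : Config (N + 1), (A Y : Config N) = fun j => Y j.succ - Y 0 := fun Y => rfl
  have h : HasFDerivAt (fun Y : Config (N + 1) => c * f (A Y))
      (c • (fderiv ℝ f (A X)).comp A) X :=
    ((hf (A X)).hasFDerivAt.comp X A.hasFDerivAt).const_mul c
  simp only [hAX] at h
  exact h

/-- Bath derivatives of the lift: `∂_{j+1,u}Ψ(X) = c ∂_{j,u}f(x₁ - x₀, …)`. [folklore] -/
private theorem fderiv_lift_single_succ {f : Config N → ℂ} (hf : Differentiable ℝ f) (c : ℂ)
    (X : Config (N + 1)) (j : Fin N) (u : Space) :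
    fderiv ℝ (fun X : Config (N + 1) => c * f (fun j => X j.succ - X 0)) X (Pi.single j.succ u) =
      c * fderiv ℝ f (fun j => X j.succ - X 0) (Pi.single j u) := by
  rw [(hasFDerivAt_lift hf c X).fderiv, smul_apply, ContinuousLinearMap.comp_apply, smul_eq_mul]
  congr 2
  funext i
  simp only [ContinuousLinearMap.pi_apply, sub_apply, ContinuousLinearMap.proj_apply]
  rw [Pi.single_eq_of_ne' (Fin.succ_ne_zero j), sub_zero]
  simp only [Pi.single_apply, Fin.succ_inj]

/-- Tagged derivative of the lift: `∂_{0,u}Ψ(X) = -c ∑ⱼ ∂_{j,u}f(x₁ - x₀, …)`. [folklore] -/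
private theorem fderiv_lift_single_zero {f : Config N → ℂ} (hf : Differentiable ℝ f) (c : ℂ)
    (X : Config (N + 1)) (u : Space) :
    fderiv ℝ (fun X : Config (N + 1) => c * f (fun j => X j.succ - X 0)) X (Pi.single 0 u) =
      -(c * ∑ j : Fin N, fderiv ℝ f (fun j => X j.succ - X 0) (Pi.single j u)) := by
  rw [(hasFDerivAt_lift hf c X).fderiv, smul_apply, ContinuousLinearMap.comp_apply, smul_eq_mul,
    ← map_sum, ← mul_neg, ← map_neg]
  congr 2
  have hsum : (∑ j : Fin N, Pi.single j u : Config N) = fun _ => u :=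
    Finset.univ_sum_single fun _ : Fin N => u
  rw [hsum]
  funext i
  simp only [ContinuousLinearMap.pi_apply, sub_apply, ContinuousLinearMap.proj_apply,
    Pi.single_eq_same, Pi.neg_apply]
  rw [Pi.single_eq_of_ne (Fin.succ_ne_zero i), zero_sub]

/-- **Bath kinetic density of the lift**: `∑ⱼ |∇_{j+1}Ψ(X)|² = ‖c‖² |∇f|²(x₁ - x₀, …)`.
[folklore] -/
private theorem sum_gradSqAt_succ_lift {f : Config N → ℂ} (hf : Differentiable ℝ f) (c : ℂ)
    (X : Config (N + 1)) :
    ∑ j : Fin N, ∑ k : Fin 3, (‖fderiv ℝ (fun X : Config (N + 1) => c * f (fun j => X j.succ - X 0))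
        X (Pi.single j.succ (EuclideanSpace.single k (1 : ℝ)))‖₊ : ℝ≥0∞) ^ 2 =
      (‖c‖₊ : ℝ≥0∞) ^ 2 * kineticDensity f (fun j => X j.succ - X 0) := by
  rw [kineticDensity, Finset.mul_sum]
  refine Finset.sum_congr rfl fun j _ => ?_
  rw [Finset.mul_sum]
  refine Finset.sum_congr rfl fun k _ => ?_
  rw [fderiv_lift_single_succ hf, nnnorm_mul, ENNReal.coe_mul, mul_pow]

/-- **Cauchy–Schwarz for a finite sum**, `ℝ≥0∞` form: `‖∑ⱼ aⱼ‖² ≤ N ∑ⱼ ‖aⱼ‖²`. [folklore] -/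
private theorem sq_nnnorm_sum_le (a : Fin N → ℂ) :
    (‖∑ j, a j‖₊ : ℝ≥0∞) ^ 2 ≤ (N : ℝ≥0∞) * ∑ j, (‖a j‖₊ : ℝ≥0∞) ^ 2 := by
  have h2 : (∑ j, ‖a j‖₊) ^ 2 ≤ (∑ _j : Fin N, (1 : ℝ≥0)) * ∑ j, ‖a j‖₊ ^ 2 :=
    Finset.sum_sq_le_sum_mul_sum_of_sq_le_mul _ (fun _ _ => zero_le_one) (fun _ _ => zero_le)
      fun _ _ => by rw [one_mul]
  rw [Finset.sum_const, Finset.card_univ, Fintype.card_fin, nsmul_eq_mul, mul_one] at h2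
  have h3 : ‖∑ j, a j‖₊ ^ 2 ≤ (N : ℝ≥0) * ∑ j, ‖a j‖₊ ^ 2 :=
    (pow_le_pow_left₀ zero_le (nnnorm_sum_le _ _) 2).trans h2
  exact_mod_cast h3

/-- **Tagged kinetic density of the lift** (Cauchy–Schwarz):
`|∇₀Ψ(X)|² ≤ ‖c‖² · N · |∇f|²(x₁ - x₀, …)`. [folklore] -/
private theorem gradSqAt_zero_lift_le {f : Config N → ℂ} (hf : Differentiable ℝ f) (c : ℂ)
    (X : Config (N + 1)) :
    ∑ k : Fin 3, (‖fderiv ℝ (fun X : Config (N + 1) => c * f (fun j => X j.succ - X 0))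
        X (Pi.single 0 (EuclideanSpace.single k (1 : ℝ)))‖₊ : ℝ≥0∞) ^ 2 ≤
      (‖c‖₊ : ℝ≥0∞) ^ 2 * ((N : ℝ≥0∞) * kineticDensity f (fun j => X j.succ - X 0)) := by
  calc ∑ k : Fin 3, (‖fderiv ℝ (fun X : Config (N + 1) => c * f (fun j => X j.succ - X 0))
          X (Pi.single 0 (EuclideanSpace.single k (1 : ℝ)))‖₊ : ℝ≥0∞) ^ 2
      = ∑ k : Fin 3, (‖c‖₊ : ℝ≥0∞) ^ 2 * (‖∑ j : Fin N, fderiv ℝ f (fun j => X j.succ - X 0)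
          (Pi.single j (EuclideanSpace.single k (1 : ℝ)))‖₊ : ℝ≥0∞) ^ 2 := by
        refine Finset.sum_congr rfl fun k _ => ?_
        rw [fderiv_lift_single_zero hf, nnnorm_neg, nnnorm_mul, ENNReal.coe_mul, mul_pow]
    _ ≤ ∑ k : Fin 3, (‖c‖₊ : ℝ≥0∞) ^ 2 * ((N : ℝ≥0∞) * ∑ j : Fin N,
          (‖fderiv ℝ f (fun j => X j.succ - X 0)
            (Pi.single j (EuclideanSpace.single k (1 : ℝ)))‖₊ : ℝ≥0∞) ^ 2) := by
        gcongr with k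
        exact sq_nnnorm_sum_le _
    _ = (‖c‖₊ : ℝ≥0∞) ^ 2 * ((N : ℝ≥0∞) * kineticDensity f (fun j => X j.succ - X 0)) := by
        rw [kineticDensity, Finset.sum_comm, Finset.mul_sum, Finset.mul_sum]

/-! ### The pinned-scatterer energy density -/

/-- The periodised potential of a measurable profile is measurable. [folklore] -/
private theorem measurable_periodizedPotential_lift {v : ℝ → ℝ≥0∞} (hv : Measurable v) (L : ℝ) :
    Measurable (periodizedPotential v L) := by
  show Measurable fun x => ∑' n : Fin 3 → ℤ, v ‖x - latticeVec L n‖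
  exact Measurable.tsum fun n => hv.comp (measurable_id.sub_const _).norm

/-- The pinned-scatterer potential term `x ↦ ∑ⱼ v^per(xⱼ) |χ|²` is measurable. [folklore] -/
private theorem measurable_impurityTerm {v : ℝ → ℝ≥0∞} (hv : Measurable v)
    (χ : PeriodicTrialState N L) :
    Measurable fun Z : Config N => impurityInteraction v L 0 Z * (‖χ.ψ Z‖₊ : ℝ≥0∞) ^ 2 := by
  refine Measurable.mul ?_ χ.measurable_normSq
  unfold impurityInteraction
  refine Finset.measurable_sum _ fun j _ => ?_
  exact (measurable_periodizedPotential_lift hv L).comp ((measurable_pi_apply j).sub_const _)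

/-- The pinned-scatterer energy density `|∇χ|² + (∑_{i<j} v^per(xᵢ - xⱼ) + ∑ⱼ v^per(xⱼ)) |χ|²` is
measurable (measurable `v`). [folklore] -/
private theorem measurable_impurityDensity {v : ℝ → ℝ≥0∞} (hv : Measurable v)
    (χ : PeriodicTrialState N L) :
    Measurable fun Z : Config N => kineticDensity χ.ψ Z +
      (periodicInteraction v L Z + impurityInteraction v L 0 Z) * (‖χ.ψ Z‖₊ : ℝ≥0∞) ^ 2 := by
  have hp : Measurable (periodizedPotential v L) := measurable_periodizedPotential_lift hv L
  have hKD : Measurable (kineticDensity χ.ψ) :=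
    Finset.measurable_sum _ fun i _ => measurable_gradSqAt i χ.ψ
  have hPI : Measurable fun Z : Config N => periodicInteraction v L Z := by
    unfold periodicInteraction
    refine Finset.measurable_sum _ fun i _ => Finset.measurable_sum _ fun j _ => ?_
    exact hp.comp ((measurable_pi_apply i).sub (measurable_pi_apply j))
  have hII : Measurable fun Z : Config N => impurityInteraction v L 0 Z := by
    unfold impurityInteraction
    refine Finset.measurable_sum _ fun j _ => ?_
    exact hp.comp ((measurable_pi_apply j).sub_const _)
  exact hKD.add ((hPI.add hII).mul χ.measurable_normSq)

/-- The pinned-scatterer energy density is periodic in every particle and axis. [folklore] -/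
private theorem impurityDensity_add_single (v : ℝ → ℝ≥0∞) (χ : PeriodicTrialState N L)
    (Z : Config N) (i : Fin N) (k : Fin 3) :
    kineticDensity χ.ψ (Z + Pi.single i (EuclideanSpace.single k L)) +
        (periodicInteraction v L (Z + Pi.single i (EuclideanSpace.single k L)) +
            impurityInteraction v L 0 (Z + Pi.single i (EuclideanSpace.single k L))) *
          (‖χ.ψ (Z + Pi.single i (EuclideanSpace.single k L))‖₊ : ℝ≥0∞) ^ 2 =
      kineticDensity χ.ψ Z +
        (periodicInteraction v L Z + impurityInteraction v L 0 Z) * (‖χ.ψ Z‖₊ : ℝ≥0∞) ^ 2 := by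
  rw [χ.kineticDensity_add_single, periodicInteraction_add_single, impurityInteraction_add_single,
    χ.periodic]

/-- The pinned-scatterer energy density integrates to `impurityPeriodicEnergy v 0 χ`. [folklore] -/
private theorem lintegral_impurityDensity {v : ℝ → ℝ≥0∞} (hv : Measurable v)
    (χ : PeriodicTrialState N L) :
    ∫⁻ Z in cellN N L, (kineticDensity χ.ψ Z +
        (periodicInteraction v L Z + impurityInteraction v L 0 Z) * (‖χ.ψ Z‖₊ : ℝ≥0∞) ^ 2) =
      impurityPeriodicEnergy v 0 χ := by
  rw [impurityPeriodicEnergy_eq, periodicEnergy,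
    ← lintegral_add_right _ (measurable_impurityTerm hv χ)]
  exact lintegral_congr fun Z => by ring

/-! ### The pointwise energy bound and its integral -/

/-- `T ≤ c (1 + a) K ⇒ T + (I + P)(c n) ≤ c (1 + a)(K + (P + I) n)` in `ℝ≥0∞`. [folklore] -/
private theorem add_mul_le_aux {T K P I n c a : ℝ≥0∞} (hT : T ≤ c * (1 + a) * K) :
    T + (I + P) * (c * n) ≤ c * (1 + a) * (K + (P + I) * n) := by
  calc T + (I + P) * (c * n)
      ≤ c * (1 + a) * K + ((I + P) * (c * n) + a * ((I + P) * (c * n))) :=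
        add_le_add hT le_self_add
    _ = c * (1 + a) * (K + (P + I) * n) := by ring

/-- **Pointwise energy density of the lift.** At `X = (x₀, …, x_N)`, with
`Z = (x₁ - x₀, …, x_N - x₀)`:
`κ|∇₀Ψ|² + ∑_{j≥1}|∇ⱼΨ|² + (∑_{j≥1} v^per(xⱼ - x₀) + ∑_{1≤i<j} v^per(xᵢ - xⱼ))|Ψ|²
 ≤ ‖c‖² (1 + κN) (|∇χ|²(Z) + (∑_{i<j} v^per(zᵢ - zⱼ) + ∑ⱼ v^per(zⱼ)) |χ(Z)|²)`
(Cauchy–Schwarz for the tagged gradient; the potentials only see differences). [folklore] -/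
private theorem integrand_lift_le {v : ℝ → ℝ≥0∞} (κ : ℝ) (χ : PeriodicTrialState N L) (c : ℂ)
    (X : Config (N + 1)) :
    taggedKineticDensity κ (fun X : Config (N + 1) => c * χ.ψ (fun j => X j.succ - X 0)) X +
        taggedInteraction v L X * (‖c * χ.ψ (fun j => X j.succ - X 0)‖₊ : ℝ≥0∞) ^ 2 ≤
      (‖c‖₊ : ℝ≥0∞) ^ 2 * (1 + ENNReal.ofReal κ * N) *
        (kineticDensity χ.ψ (fun j => X j.succ - X 0) +
          (periodicInteraction v L (fun j => X j.succ - X 0) +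
              impurityInteraction v L 0 (fun j => X j.succ - X 0)) *
            (‖χ.ψ (fun j => X j.succ - X 0)‖₊ : ℝ≥0∞) ^ 2) := by
  have hχd : Differentiable ℝ χ.ψ := χ.contDiff.differentiable one_ne_zero
  -- kinetic part: bath gradients exactly, tagged gradient by Cauchy–Schwarz
  have hkin :
      taggedKineticDensity κ (fun X : Config (N + 1) => c * χ.ψ (fun j => X j.succ - X 0)) X ≤
        (‖c‖₊ : ℝ≥0∞) ^ 2 * (1 + ENNReal.ofReal κ * N) *
          kineticDensity χ.ψ (fun j => X j.succ - X 0) := by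
    rw [taggedKineticDensity_def, sum_gradSqAt_succ_lift hχd c X]
    calc _ ≤ ENNReal.ofReal κ * ((‖c‖₊ : ℝ≥0∞) ^ 2 *
            ((N : ℝ≥0∞) * kineticDensity χ.ψ (fun j => X j.succ - X 0))) +
          (‖c‖₊ : ℝ≥0∞) ^ 2 * kineticDensity χ.ψ (fun j => X j.succ - X 0) :=
          add_le_add (mul_le_mul' le_rfl (gradSqAt_zero_lift_le hχd c X)) le_rfl
      _ = _ := by ring
  -- potential part: the bath configuration is `Z + x₀𝟙`, the scatterer sits at `0 + x₀`
  have htail : Matrix.vecTail X = (fun j : Fin N => X j.succ - X 0) + fun _ => X 0 := by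
    funext j
    simp only [Matrix.vecTail, Function.comp_apply, Pi.add_apply, sub_add_cancel]
  have hpot : taggedInteraction v L X = impurityInteraction v L 0 (fun j => X j.succ - X 0) +
      periodicInteraction v L (fun j => X j.succ - X 0) := by
    rw [taggedInteraction_eq, htail, periodicInteraction_add_const,
      ← impurityInteraction_add_const v L 0 _ (X 0), zero_add]
  rw [hpot, nnnorm_mul, ENNReal.coe_mul, mul_pow]
  exact add_mul_le_aux hkin

/-- **Energy of the zero-momentum lift.** For measurable `v`, `0 < L` and the lift `Ψ` of `χ`,
`⟨Ψ, H_κ Ψ⟩ ≤ (1 + κ N) · impurityPeriodicEnergy v 0 χ`: integrate the pointwise bound with Tonelli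
(tagged coordinate outermost) and the shift of the fundamental cell; `‖(√(L³))⁻¹‖² · L³ = 1`.
[folklore] -/
theorem taggedPeriodicEnergy_zeroMomentumLift_le {v : ℝ → ℝ≥0∞} (hv : Measurable v) (hL : 0 < L)
    (κ : ℝ) (χ : PeriodicTrialState N L) {Ψ : TaggedPeriodicTrialState N L}
    (hΨ : Ψ.ψ = fun X => ((Real.sqrt (L ^ 3))⁻¹ : ℂ) * χ.ψ (fun j => X j.succ - X 0)) :
    taggedPeriodicEnergy v κ Ψ ≤ (1 + ENNReal.ofReal κ * N) * impurityPeriodicEnergy v 0 χ := by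
  have hL3 : ENNReal.ofReal L ^ 3 ≠ 0 := pow_ne_zero _ (ENNReal.ofReal_pos.2 hL).ne'
  have hL3' : ENNReal.ofReal L ^ 3 ≠ ⊤ := ENNReal.pow_ne_top ENNReal.ofReal_ne_top
  have hK : (‖((Real.sqrt (L ^ 3))⁻¹ : ℂ)‖₊ : ℝ≥0∞) ^ 2 * (1 + ENNReal.ofReal κ * N) ≠ ⊤ :=
    ENNReal.mul_ne_top (ENNReal.pow_ne_top ENNReal.coe_ne_top) (ENNReal.add_ne_top.2
      ⟨ENNReal.one_ne_top, ENNReal.mul_ne_top ENNReal.ofReal_ne_top (ENNReal.natCast_ne_top N)⟩)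
  rw [taggedPeriodicEnergy_def, hΨ]
  refine (lintegral_mono fun X => integrand_lift_le κ χ _ X).trans (le_of_eq ?_)
  rw [lintegral_const_mul' _ _ hK,
    lintegral_cellN_succ_rel hL (measurable_impurityDensity hv χ) (impurityDensity_add_single v χ),
    lintegral_impurityDensity hv χ, nnnorm_constantMode_sq hL]
  rw [mul_comm (ENNReal.ofReal L ^ 3)⁻¹, mul_assoc, ← mul_assoc (ENNReal.ofReal L ^ 3)⁻¹,
    ENNReal.inv_mul_cancel hL3 hL3', one_mul]

/-! ### The stub -/

/-- **Stub `stub_zeroMomentumLift` of crux `RecoilTransfer` (route `BECProbeMassFlow`), exact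
registered signature: the zero-momentum lift.** For measurable `v ≥ 0`, `0 < L`, any mass ratio
`κ` and any pinned-scatterer trial state `χ` (`N` periodic bosons, scatterer at `0`),
`E_κ(N, L) = taggedPeriodicGroundStateEnergy v κ N L ≤ (1 + κ N) · impurityPeriodicEnergy v 0 χ`:
the variational principle on the lift `Ψ(x₀, Y) = L^{-3/2} χ(Y - x₀𝟙)`, whose energy is at most
`(1 + κN) ⟨χ, (H + ∑ⱼ v^per(xⱼ)) χ⟩` (`|∑ⱼ ∇ⱼχ|² ≤ N ∑ⱼ |∇ⱼχ|²`). [folklore] -/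
theorem stub_zeroMomentumLift :
    ∀ v : ℝ → ℝ≥0∞, Measurable v → ∀ (N : ℕ) (L : ℝ), 0 < L → ∀ κ : ℝ,
      ∀ χ : PeriodicTrialState N L,
        taggedPeriodicGroundStateEnergy v κ N L ≤
          (1 + ENNReal.ofReal κ * N) * impurityPeriodicEnergy v 0 χ := by
  intro v hv N L hL κ χ
  obtain ⟨Ψ, hΨ⟩ := zeroMomentumLift_exists hL χ
  exact (taggedPeriodicGroundStateEnergy_le v κ Ψ).trans
    (taggedPeriodicEnergy_zeroMomentumLift_le hv hL κ χ hΨ)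

end Summit.AtomisticToContinuum.BoseEinsteinCondensation.Theorems

end
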